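import Mathlib.Analysis.Complex.TaylorSeries
import Mathlib.Analysis.Analytic.IsolatedZeros
import Mathlib.Analysis.Analytic.OfScalars
import Mathlib.Analysis.SpecialFunctions.Exponential
import Mathlib.Analysis.SpecificLimits.Normed
import Mathlib.Analysis.Normed.Ring.InfiniteSum
import Literature.Analysis.TotalPositivity.PolyaFrequency
import Literature.Analysis.TotalPositivity.PolyaFrequencyReciprocal
import Literature.Analysis.TotalPositivity.PolyaFrequencyEntire
import Literature.Analysis.TotalPositivity.PolyaFrequencyZeros
import HarnessLib

/-!
# The Aissen–Schoenberg–Whitney–Edrei representation: the elementary half (proved), the two deep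
# inputs (named facts), and the assembly of `aswe_edrei`

Trunk T-ANALYSIS (Literature/Analysis/TotalPositivity). Part 2 of the decomposition of the named
fact `Literature.Analysis.TotalPositivity.aswe_edrei` (PolyaFrequency.lean): "a real sequence `(aₙ)` with `a₀ > 0`
is PF iff near `0`, `Σ aₙ wⁿ = C e^{γw} ∏(1 + αᵢw)/∏(1 - βᵢw)`" — Aissen–Edrei–Schoenberg–Whitney
1951, Thm. 4 (announcement; proofs in Aissen–Schoenberg–Whitney 1952 and Edrei 1952) = Karlin
1968, Ch. 8, Thm. 5.3. The printed proof of Thm. 4 [AissenEdreiSchoenbergWhitney1951, p. 305]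
has exactly three inputs, which this file keeps apart:

* **Thm. 1** (the elementary half, PROVED here as `IsPolyaFrequencySeq.of_hasASWERepresentation`):
  functions of the form (5) generate totally positive sequences. Printed proof (p. 304): closure
  under products and limits, and the three generating functions `1 + αz`, `1/(1 - βz)`, `e^{γz}`.
  Lean proof: the Taylor sequence of the right-hand side is
  `s = (C γⁿ/n!) ⋆ p_α ⋆ negRecipSeq p_β`, where `p_α`, `p_β` are the (real) Taylor sequences of
  the entire functions `∏(1 + αᵢ z)`, `∏(1 + βᵢ z)` (PF: `isPolyaFrequencySeq_taylor_of_hasProd`,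
  PolyaFrequencyEntire.lean), `negRecipSeq p_β` is the Taylor sequence of `1/∏(1 - βᵢ z)` (PF by
  the reciprocal rule `IsPolyaFrequencySeq.negRecipSeq`, PolyaFrequencyReciprocal.lean),
  `(γⁿ/n!)` is PF (`isPolyaFrequencySeq_exp`) and `⋆` preserves PF (`IsPolyaFrequencySeq.conv`);
  two Cauchy products show `Σ sₙ zⁿ = C e^{γz} ∏(1 + αᵢ z)/∏(1 - βᵢ z)` on a complex disc, and
  the identity theorem on that disc (the two sides agree at real points, by hypothesis) gives
  `a = s`.
* **Thm. 2** (Aissen–Schoenberg–Whitney 1952; NAMED FACT `asw1952_representation`): a PF sequence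
  with `a₀ = 1` has a generating function, regular near `0`, which extends to a meromorphic
  function `e^{g(z)} ∏(1 + α_ν z)/∏(1 - β_ν z)` (`α_ν, β_ν ≥ 0`, `Σ α_ν, Σ β_ν < ∞`) with `g`
  entire and `e^{g}` itself generating a totally positive sequence (proved in print by Hadamard's
  theory of polar singularities and Whitney's reduction theorem).
* **Thm. 3** (Edrei 1952; NAMED FACT `edrei1952_exponential_factor`): if `g(z) = c₁z + c₂z² + ⋯`
  is entire and `e^{g}` generates a totally positive sequence then `g(z) = c₁ z`, `c₁ ≥ 0`
  (Nevanlinna theory).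
* **Thm. 4** = `aswe_edrei`, assembled here as `aswe_edrei_of : asw1952_representation →
  edrei1952_exponential_factor → aswe_edrei` (normalise `a₀ = 1`, subtract `g(0)`, apply Thm. 3,
  transport the complex identity to the real interval; the converse is Thm. 1).

Nothing is asserted by the two named facts; `aswe_edrei` itself stays a named fact until they are
discharged (`aswe_edrei_holds` would be `aswe_edrei_of asw1952_representation_holds
edrei1952_exponential_factor_holds`). Part 4b of this decomposition (`ASWMeromorphic.lean`) proves
Thm. 2 from the finite-dimensional recognition theorem `ando1987_lowerTriangular_tn`
(PolyaFrequencyRecognition.lean) by an elementary pole-stripping argument, leaving Edrei's Thm. 3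
as the only deep input.

## References

* M. Aissen, A. Edrei, I. J. Schoenberg, A. Whitney, *On the generating functions of totally
  positive sequences*, Proc. Nat. Acad. Sci. USA 37 (1951) 303–307, Thms. 1–4 (pp. 304–305).
  [AissenEdreiSchoenbergWhitney1951]
* M. Aissen, I. J. Schoenberg, A. M. Whitney, *On the generating functions of totally positive
  sequences I*, J. Analyse Math. 2 (1952) 93–103. [AissenSchoenbergWhitney1952]
* A. Edrei, *On the generating functions of totally positive sequences II*, J. Analyse Math. 2
  (1952) 104–109. [Edrei1952]
* S. Karlin, *Total Positivity I*, Stanford UP 1968, Ch. 8, Thm. 5.3. [Karlin1968]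
* J. P. S. Kung, G.-C. Rota, C. H. Yan, *Combinatorics: The Rota Way*, CUP 2009, Thm. 6.9.1 and
  footnote 21 (the division of labour between ASW 1952 and Edrei 1952). [KungRotaYan2009]
-/

noncomputable section

open Filter Complex Metric Finset
open scoped Topology Nat NNReal ENNReal ComplexConjugate

namespace Literature.Analysis.TotalPositivity

/-! ### A. Complex power series with real coefficients -/

/-- A real power series converging on `(-ρ, ρ)` converges absolutely on the complex disc
`‖z‖ < ρ` (comparison with a geometric series through the radius of convergence). [folklore] -/
theorem summable_norm_ofReal_mul_pow {a : ℕ → ℝ} {ρ : ℝ}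
    (hs : ∀ w : ℝ, 0 ≤ w → w < ρ → Summable fun n => a n * w ^ n) {z : ℂ} (hz : ‖z‖ < ρ) :
    Summable fun n => ‖(a n : ℂ) * z ^ n‖ := by
  set p : FormalMultilinearSeries ℂ ℂ ℂ := FormalMultilinearSeries.ofScalars ℂ (fun n => (a n : ℂ))
    with hp
  obtain ⟨w, hzw, hwρ⟩ := exists_between hz
  have hw0 : 0 ≤ w := (norm_nonneg z).trans hzw.le
  have hrad : ((w.toNNReal : ℝ≥0) : ℝ≥0∞) ≤ p.radius := by
    refine p.le_radius_of_tendsto (l := 0) ?_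
    have hsum := (hs w hw0 hwρ).tendsto_atTop_zero
    have : (fun n => ‖p n‖ * ((w.toNNReal : ℝ≥0) : ℝ) ^ n) = fun n => ‖a n * w ^ n‖ := by
      funext n
      simp [hp, Real.coe_toNNReal w hw0, abs_of_nonneg hw0]
    rw [this]
    exact tendsto_zero_iff_norm_tendsto_zero.1 hsum
  have hlt : ((‖z‖₊ : ℝ≥0) : ℝ≥0∞) < p.radius := by
    refine lt_of_lt_of_le ?_ hrad
    rw [ENNReal.coe_lt_coe]
    have h1 : (‖z‖₊ : ℝ) < (w.toNNReal : ℝ) := by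
      rw [Real.coe_toNNReal w hw0, coe_nnnorm]; exact hzw
    exact_mod_cast h1
  have := p.summable_norm_mul_pow hlt
  refine this.congr fun n => ?_
  simp [hp, norm_pow]

/-- Real infinite products `∏ (1 + αᵢ w)` cast to `ℂ`. [folklore] -/
theorem ofReal_tprod_one_add_mul {α : ℕ → ℝ} (hα : Summable α) (w : ℝ) :
    (((∏' i, (1 + α i * w) : ℝ) : ℂ)) = ∏' i, (1 + (α i : ℂ) * (w : ℂ)) := by
  have hs : Summable fun i => ‖α i * w‖ := (hα.mul_right w).norm
  have hm : Multipliable fun i => (1 : ℝ) + α i * w := multipliable_one_add_of_summable hs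
  have := (hm.hasProd.map Complex.ofRealHom Complex.continuous_ofReal).tprod_eq
  rw [Complex.ofRealHom_eq_coe] at this
  rw [← this]
  exact tprod_congr fun i => by simp [Function.comp_apply]

/-- Real infinite products `∏ (1 - βᵢ w)` cast to `ℂ`. [folklore] -/
theorem ofReal_tprod_one_sub_mul {β : ℕ → ℝ} (hβ : Summable β) (w : ℝ) :
    (((∏' i, (1 - β i * w) : ℝ) : ℂ)) = ∏' i, (1 - (β i : ℂ) * (w : ℂ)) := by
  have h := ofReal_tprod_one_add_mul hβ.neg w
  have h1 : (∏' i, (1 + -β i * w) : ℝ) = ∏' i, (1 - β i * w) := tprod_congr fun i => by ring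
  have h2 : (∏' i, (1 + ((-β i : ℝ) : ℂ) * (w : ℂ))) = ∏' i, (1 - (β i : ℂ) * (w : ℂ)) :=
    tprod_congr fun i => by push_cast; ring
  rw [← h1, ← h2]
  exact h

/-- Summability of `‖(αᵢ : ℂ)‖` for a non-negative summable real sequence. [folklore] -/
theorem summable_norm_ofReal {α : ℕ → ℝ} (hα : ∀ i, 0 ≤ α i) (hs : Summable α) :
    Summable fun i => ‖((α i : ℝ) : ℂ)‖ := by
  simpa [Complex.norm_real, Real.norm_of_nonneg (hα _)] using hs

/-- The entire function `P(z) = ∏ (1 + αᵢ z)` (`αᵢ` real, `Σ|αᵢ| < ∞`) commutes with complex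
conjugation. [folklore] -/
theorem conj_tprod_one_add {α : ℕ → ℝ} (hα : Summable fun i => ‖((α i : ℝ) : ℂ)‖) (z : ℂ) :
    conj (∏' i, (1 + (α i : ℂ) * z)) = ∏' i, (1 + (α i : ℂ) * conj z) := by
  have h1 := (hasProd_one_add hα z).map (starRingEnd ℂ) Complex.continuous_conj
  have h2 := hasProd_one_add hα (conj z)
  refine h1.unique ?_
  convert h2 using 1
  funext i
  simp [Function.comp_apply, Complex.conj_ofReal]

/-- The Taylor coefficients at `0` of `P(z) = ∏ (1 + αᵢ z)` (`αᵢ` real) are real. [folklore] -/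
theorem im_iteratedDeriv_tprod_one_add {α : ℕ → ℝ} (hα : Summable fun i => ‖((α i : ℝ) : ℂ)‖)
    (n : ℕ) : (iteratedDeriv n (fun z => ∏' i, (1 + (α i : ℂ) * z)) 0).im = 0 := by
  set P : ℂ → ℂ := fun z => ∏' i, (1 + (α i : ℂ) * z) with hP
  have hPd : Differentiable ℂ P := differentiable_tprod_one_add hα
  set c : ℕ → ℂ := fun n => iteratedDeriv n P 0 / n ! with hc
  have hPs : ∀ z : ℂ, HasSum (fun n => c n * z ^ n) (P z) := fun z =>
    hasSum_taylorCoeff_of_differentiableOn (hPd.differentiableOn (s := ball (0 : ℂ) (‖z‖ + 1)))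
      (by linarith [norm_nonneg z])
  -- the conjugate series also sums to `P`
  have hconj : ∀ z : ℂ, HasSum (fun n => conj (c n) * z ^ n) (P z) := by
    intro z
    have h := (hPs (conj z)).map (starRingEnd ℂ) Complex.continuous_conj
    have hval : conj (P (conj z)) = P z := by
      rw [hP]; simp only
      rw [conj_tprod_one_add hα, Complex.conj_conj]
    rw [hval] at h
    convert h using 1
    funext n
    simp [Function.comp_apply]
  have heq := taylorCoeff_eq_of_hasSum (r := 1) one_pos (fun z _ => hconj z) n
  -- `c n = conj (c n)`
  have hcn : conj (c n) = c n := heq.symm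
  have him : (c n).im = 0 := Complex.conj_eq_iff_im.1 hcn
  have : iteratedDeriv n P 0 = c n * n ! := by
    rw [hc]
    have : (n ! : ℂ) ≠ 0 := by exact_mod_cast n.factorial_ne_zero
    field_simp
  rw [this, Complex.mul_im, him]
  simp

/-- The real Taylor sequence `pₙ = Re P⁽ⁿ⁾(0)/n!` of `P(z) = ∏ (1 + αᵢ z)` sums to `P` on `ℂ`.
[folklore] -/
theorem hasSum_taylor_tprod_one_add {α : ℕ → ℝ} (hα : Summable fun i => ‖((α i : ℝ) : ℂ)‖)
    (z : ℂ) :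
    HasSum (fun n => (((iteratedDeriv n (fun z => ∏' i, (1 + (α i : ℂ) * z)) 0).re / n ! : ℝ) : ℂ)
      * z ^ n) (∏' i, (1 + (α i : ℂ) * z)) := by
  set P : ℂ → ℂ := fun z => ∏' i, (1 + (α i : ℂ) * z) with hP
  have hPd : Differentiable ℂ P := differentiable_tprod_one_add hα
  have hPs : HasSum (fun n => (iteratedDeriv n P 0 / n !) * z ^ n) (P z) :=
    hasSum_taylorCoeff_of_differentiableOn (hPd.differentiableOn (s := ball (0 : ℂ) (‖z‖ + 1)))
      (by linarith [norm_nonneg z])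
  convert hPs using 2 with n
  congr 1
  have him : (iteratedDeriv n P 0).im = 0 := im_iteratedDeriv_tprod_one_add hα n
  have hre : ((iteratedDeriv n P 0).re : ℂ) = iteratedDeriv n P 0 := by
    apply Complex.ext
    · simp
    · simp [him]
  push_cast
  rw [hre]

/-- The Taylor coefficient identity `P⁽ⁿ⁾(0)/n! = pₙ` for the real Taylor sequence. [folklore] -/
theorem taylorCoeff_tprod_one_add {α : ℕ → ℝ} (hα : Summable fun i => ‖((α i : ℝ) : ℂ)‖)
    (n : ℕ) :
    iteratedDeriv n (fun z => ∏' i, (1 + (α i : ℂ) * z)) 0 / n ! =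
      (((iteratedDeriv n (fun z => ∏' i, (1 + (α i : ℂ) * z)) 0).re / n ! : ℝ) : ℂ) :=
  (taylorCoeff_eq_of_hasSum (r := 1) one_pos (fun z _ => hasSum_taylor_tprod_one_add hα z) n)

/-- **PF Taylor sequence of `∏ (1 + αᵢ z)`** (`αᵢ ≥ 0`, `Σ αᵢ < ∞`), the case `C = 1` of
`isPolyaFrequencySeq_taylor_of_hasProd`. [Aissen–Edrei–Schoenberg–Whitney 1951, Thm. 1]
[folklore] -/
theorem isPolyaFrequencySeq_taylor_tprod_one_add {α : ℕ → ℝ} (hα : ∀ i, 0 ≤ α i)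
    (hs : Summable α) :
    IsPolyaFrequencySeq fun n =>
      (iteratedDeriv n (fun z => ∏' i, (1 + (α i : ℂ) * z)) 0).re / (n ! : ℝ) := by
  have hαc := summable_norm_ofReal hα hs
  refine isPolyaFrequencySeq_taylor_of_hasProd (F := fun z => ∏' i, (1 + (α i : ℂ) * z))
    (C := 1) zero_le_one hα hs (fun z => ?_) (fun z => by simp)
  simpa using hasProd_one_add hαc z

/-- The Taylor sequence of `∏ (1 + αᵢ z)` starts with `1`. [folklore] -/
theorem taylor_tprod_one_add_zero {α : ℕ → ℝ} :
    (iteratedDeriv 0 (fun z => ∏' i, (1 + (α i : ℂ) * z)) 0).re / ((0 : ℕ) ! : ℝ) = 1 := by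
  simp

/-! ### B. The ASWE Taylor sequence and its generating function -/

/-- The (real) Taylor sequence at `0` of the entire function `∏ᵢ (1 + αᵢ z)`:
`pₙ = Re P⁽ⁿ⁾(0)/n!` (the `n`-th elementary symmetric function of the `αᵢ`). [folklore] -/
def taylorProdSeq (α : ℕ → ℝ) (n : ℕ) : ℝ :=
  (iteratedDeriv n (fun z : ℂ => ∏' i, (1 + (α i : ℂ) * z)) 0).re / (n ! : ℝ)

/-- `taylorProdSeq α 0 = 1`. [folklore] -/
@[simp] theorem taylorProdSeq_zero (α : ℕ → ℝ) : taylorProdSeq α 0 = 1 := by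
  simp [taylorProdSeq]

/-- **The ASWE Taylor sequence**: the Taylor sequence at `0` of
`C e^{γz} ∏ᵢ (1 + αᵢ z) / ∏ᵢ (1 - βᵢ z)`, written as the Cauchy product
`(C γⁿ/n!) ⋆ p_α ⋆ negRecipSeq p_β` of the Taylor sequences of the three factors `C e^{γz}`,
`∏ (1 + αᵢ z)` and `1/∏ (1 - βᵢ z)` (`hasSum_asweSeq`). [Aissen–Edrei–Schoenberg–Whitney 1951,
Thm. 1 (proof: products of the three generating functions)] [folklore] -/
def asweSeq (C γ : ℝ) (α β : ℕ → ℝ) : ℕ → ℝ :=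
  conv (conv (fun n => C * (γ ^ n / n !)) (taylorProdSeq α)) (negRecipSeq (taylorProdSeq β))

/-- **The ASWE Taylor sequence is PF** for `C ≥ 0`, `γ ≥ 0`, `αᵢ, βᵢ ≥ 0` summable: the three
factors are PF (`isPolyaFrequencySeq_exp`, `isPolyaFrequencySeq_taylor_tprod_one_add`, and the
reciprocal rule `IsPolyaFrequencySeq.negRecipSeq`) and PF is closed under `⋆`
(`IsPolyaFrequencySeq.conv`). This is Thm. 1 of AESW 1951 at the level of sequences.
[cite: AissenEdreiSchoenbergWhitney1951, Thm. 1] -/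
theorem isPolyaFrequencySeq_asweSeq {C γ : ℝ} {α β : ℕ → ℝ} (hC : 0 ≤ C) (hγ : 0 ≤ γ)
    (hα : ∀ i, 0 ≤ α i) (hαs : Summable α) (hβ : ∀ i, 0 ≤ β i) (hβs : Summable β) :
    IsPolyaFrequencySeq (asweSeq C γ α β) :=
  (((isPolyaFrequencySeq_exp hγ).smul hC).conv (isPolyaFrequencySeq_taylor_tprod_one_add hα hαs)).conv
    ((isPolyaFrequencySeq_taylor_tprod_one_add hβ hβs).negRecipSeq (taylorProdSeq_zero β))

/-- Cauchy product of two power series with real coefficients at a complex point. [folklore] -/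
theorem hasSum_conv {x y : ℕ → ℝ} {z X Y : ℂ}
    (hx : HasSum (fun n => (x n : ℂ) * z ^ n) X) (hy : HasSum (fun n => (y n : ℂ) * z ^ n) Y)
    (hx' : Summable fun n => ‖(x n : ℂ) * z ^ n‖) (hy' : Summable fun n => ‖(y n : ℂ) * z ^ n‖) :
    HasSum (fun n => (conv x y n : ℂ) * z ^ n) (X * Y) := by
  have H := hasSum_sum_range_mul_of_summable_norm hx' hy'
  rw [hx.tsum_eq, hy.tsum_eq] at H
  refine H.congr_fun fun n => ?_
  rw [conv, Finset.Nat.sum_antidiagonal_eq_sum_range_succ_mk]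
  push_cast
  rw [Finset.sum_mul]
  refine Finset.sum_congr rfl fun k hk => ?_
  rw [Finset.mem_range] at hk
  rw [← pow_mul_pow_sub z (Nat.le_of_lt_succ hk)]
  ring

/-- The Taylor series of `C e^{γz}`. [folklore] -/
theorem hasSum_exp_smul (C γ : ℝ) (z : ℂ) :
    HasSum (fun n => ((C * (γ ^ n / n !) : ℝ) : ℂ) * z ^ n) ((C : ℂ) * Complex.exp ((γ : ℂ) * z)) := by
  have h := NormedSpace.expSeries_div_hasSum_exp ((γ : ℂ) * z)
  rw [← congrFun Complex.exp_eq_exp_ℂ ((γ : ℂ) * z)] at h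
  have h2 := h.mul_left (C : ℂ)
  have h3 : (fun n => ((C * (γ ^ n / n !) : ℝ) : ℂ) * z ^ n) =
      fun n => (C : ℂ) * (((γ : ℂ) * z) ^ n / n !) := by
    funext n
    push_cast
    ring
  rw [h3]
  exact h2

/-- Absolute convergence of the Taylor series of `C e^{γz}`. [folklore] -/
theorem summable_norm_exp_smul (C γ : ℝ) (z : ℂ) :
    Summable fun n => ‖((C * (γ ^ n / n !) : ℝ) : ℂ) * z ^ n‖ := by
  have : (fun n => ‖((C * (γ ^ n / n !) : ℝ) : ℂ) * z ^ n‖) =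
      fun n => |C| * ((|γ| * ‖z‖) ^ n / n !) := by
    funext n
    rw [norm_mul, Complex.norm_real, norm_pow, Real.norm_eq_abs, abs_mul, abs_div, abs_pow,
      Nat.abs_cast, mul_pow]
    ring
  rw [this]
  exact (Real.summable_pow_div_factorial _).mul_left _

/-- On `‖z‖ < 1/(Σ βₖ + 1)` every factor `1 - βₖ z` is bounded away from `0`. [folklore] -/
theorem norm_mul_lt_one_of_lt {β : ℕ → ℝ} (hβ : ∀ i, 0 ≤ β i) (hβs : Summable β) {z : ℂ}
    (hz : ‖z‖ < (∑' k, β k + 1)⁻¹) (k : ℕ) : ‖((β k : ℝ) : ℂ)‖ * ‖z‖ < 1 := by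
  have hσ0 : 0 ≤ ∑' k, β k := tsum_nonneg hβ
  have hk : β k ≤ ∑' j, β j := hβs.le_tsum k (fun j _ => hβ j)
  rw [Complex.norm_real, Real.norm_of_nonneg (hβ k)]
  calc β k * ‖z‖ ≤ (∑' j, β j) * (∑' j, β j + 1)⁻¹ := mul_le_mul hk hz.le (norm_nonneg _) hσ0
    _ < 1 := by rw [← div_eq_mul_inv, div_lt_one (by linarith)]; linarith

/-- `∏ (1 - βₖ z) ≠ 0` on `‖z‖ < 1/(Σ βₖ + 1)`. [folklore] -/
theorem tprod_one_sub_ne_zero_of_lt {β : ℕ → ℝ} (hβ : ∀ i, 0 ≤ β i) (hβs : Summable β) {z : ℂ}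
    (hz : ‖z‖ < (∑' k, β k + 1)⁻¹) : ∏' k, (1 - (β k : ℂ) * z) ≠ 0 :=
  tprod_one_sub_ne_zero (summable_norm_ofReal hβ hβs) (norm_mul_lt_one_of_lt hβ hβs hz)

/-- `1/∏ (1 - βₖ z)` is differentiable on `‖z‖ < 1/(Σ βₖ + 1)`. [folklore] -/
theorem differentiableOn_inv_tprod_one_sub {β : ℕ → ℝ} (hβ : ∀ i, 0 ≤ β i) (hβs : Summable β) :
    DifferentiableOn ℂ (fun z => (∏' k, (1 - (β k : ℂ) * z))⁻¹) (ball (0 : ℂ) (∑' k, β k + 1)⁻¹) :=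
  fun z hz => (((differentiable_tprod_one_sub (summable_norm_ofReal hβ hβs)) z).inv
    (tprod_one_sub_ne_zero_of_lt hβ hβs (mem_ball_zero_iff.1 hz))).differentiableWithinAt

/-- **The Taylor series of `1/∏ (1 - βₖ z)`** is `Σ (negRecipSeq p_β)ₙ zⁿ` on
`‖z‖ < 1/(Σ βₖ + 1)` (`taylorCoeff_inv_eq_negRecipSeq`). [folklore] -/
theorem hasSum_negRecipSeq_taylorProdSeq {β : ℕ → ℝ} (hβ : ∀ i, 0 ≤ β i) (hβs : Summable β)
    {z : ℂ} (hz : ‖z‖ < (∑' k, β k + 1)⁻¹) :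
    HasSum (fun n => (negRecipSeq (taylorProdSeq β) n : ℂ) * z ^ n)
      ((∏' k, (1 - (β k : ℂ) * z))⁻¹) := by
  have hβc := summable_norm_ofReal hβ hβs
  have hcoef : ∀ n, iteratedDeriv n (fun z => (∏' k, (1 - (β k : ℂ) * z))⁻¹) 0 / n ! =
      (negRecipSeq (taylorProdSeq β) n : ℝ) :=
    fun n => taylorCoeff_inv_eq_negRecipSeq hβc (fun m => taylorCoeff_tprod_one_add hβc m) n
  have := hasSum_taylorCoeff_of_differentiableOn (differentiableOn_inv_tprod_one_sub hβ hβs) hz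
  simpa only [hcoef] using this

/-- **Generating function of the ASWE Taylor sequence**: for `‖z‖ < 1/(Σ βₖ + 1)`,
`Σ (asweSeq C γ α β)ₙ zⁿ = C e^{γz} ∏ (1 + αᵢ z) · (∏ (1 - βₖ z))⁻¹` (two Cauchy products).
[Aissen–Edrei–Schoenberg–Whitney 1951, Thm. 1] [folklore] -/
theorem hasSum_asweSeq (C γ : ℝ) {α β : ℕ → ℝ} (hα : ∀ i, 0 ≤ α i) (hαs : Summable α)
    (hβ : ∀ i, 0 ≤ β i) (hβs : Summable β) {z : ℂ} (hz : ‖z‖ < (∑' k, β k + 1)⁻¹) :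
    HasSum (fun n => (asweSeq C γ α β n : ℂ) * z ^ n)
      ((C : ℂ) * Complex.exp ((γ : ℂ) * z) * (∏' i, (1 + (α i : ℂ) * z)) *
        (∏' k, (1 - (β k : ℂ) * z))⁻¹) := by
  have hαc := summable_norm_ofReal hα hαs
  have hρpos : 0 < (∑' k, β k + 1)⁻¹ :=
    inv_pos.2 (by linarith [(tsum_nonneg hβ : 0 ≤ ∑' k, β k)])
  -- numerator `C e^{γz} P(z)`
  have hnum : ∀ w : ℂ, HasSum (fun n => ((conv (fun n => C * (γ ^ n / n !)) (taylorProdSeq α) n : ℝ)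
      : ℂ) * w ^ n) ((C : ℂ) * Complex.exp ((γ : ℂ) * w) * ∏' i, (1 + (α i : ℂ) * w)) := by
    intro w
    refine hasSum_conv (hasSum_exp_smul C γ w) (hasSum_taylor_tprod_one_add hαc w)
      (summable_norm_exp_smul C γ w) ?_
    exact summable_norm_of_hasSum (r := ‖w‖ + 1) (by positivity)
      (fun v _ => hasSum_taylor_tprod_one_add hαc v) (by linarith)
  have hnum' : Summable fun n => ‖((conv (fun n => C * (γ ^ n / n !)) (taylorProdSeq α) n : ℝ)
      : ℂ) * z ^ n‖ :=
    summable_norm_of_hasSum (r := ‖z‖ + 1) (by positivity) (fun v _ => hnum v) (by linarith)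
  have hden := hasSum_negRecipSeq_taylorProdSeq hβ hβs hz
  have hden' : Summable fun n => ‖((negRecipSeq (taylorProdSeq β) n : ℝ) : ℂ) * z ^ n‖ :=
    summable_norm_of_hasSum hρpos (fun v hv => hasSum_negRecipSeq_taylorProdSeq hβ hβs hv) hz
  exact hasSum_conv (hnum z) hden hnum' hden'

/-! ### C. Thm. 1: the representation implies PF -/

/-- **The elementary half of the ASWE theorem** (Aissen–Edrei–Schoenberg–Whitney 1951, Thm. 1:
"The functions `f(z) = e^{γz} ∏(1 + α_ν z)/∏(1 - β_ν z)` (`γ ≥ 0, α_ν ≥ 0, β_ν ≥ 0, Σα_ν, Σβ_ν`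
convergent) generate totally positive sequences"): if the generating function of `a` has the
ASWE form on a real interval around `0` then `a` is a Pólya frequency sequence. Proof: `a`
coincides with the PF sequence `asweSeq C γ α β` — both complex power series converge on a disc
around `0` and agree at its real points, hence on the disc (identity theorem), hence
coefficientwise. [cite: AissenEdreiSchoenbergWhitney1951, Thm. 1] -/
theorem IsPolyaFrequencySeq.of_hasASWERepresentation {a : ℕ → ℝ} (h : HasASWERepresentation a) :
    IsPolyaFrequencySeq a := by
  obtain ⟨C, γ, α, β, hC, hγ, hα, hβ, hαs, hβs, ρ, hρ, hrep⟩ := h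
  suffices heq : a = asweSeq C γ α β by
    rw [heq]; exact isPolyaFrequencySeq_asweSeq hC.le hγ hα hαs hβ hβs
  -- radii
  set ρ₀ : ℝ := (∑' k, β k + 1)⁻¹ with hρ₀
  have hρ₀pos : 0 < ρ₀ := inv_pos.2 (by linarith [(tsum_nonneg hβ : 0 ≤ ∑' k, β k)])
  set ρ₁ : ℝ := min ρ ρ₀ with hρ₁
  have hρ₁pos : 0 < ρ₁ := lt_min hρ hρ₀pos
  -- the complexified series of `a`
  have hsum : ∀ z : ℂ, ‖z‖ < ρ → Summable fun n => ‖(a n : ℂ) * z ^ n‖ := fun z hz =>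
    summable_norm_ofReal_mul_pow
      (fun w hw0 hw => (hrep w (by rwa [abs_of_nonneg hw0])).summable) hz
  set h : ℂ → ℂ := fun z => ∑' n, (a n : ℂ) * z ^ n with hh
  have hhs : ∀ z : ℂ, ‖z‖ < ρ₁ → HasSum (fun n => (a n : ℂ) * z ^ n) (h z) := fun z hz =>
    (hsum z (hz.trans_le (min_le_left _ _))).of_norm.hasSum
  -- the series of `asweSeq`
  set S : ℂ → ℂ := fun z => ∑' n, (asweSeq C γ α β n : ℂ) * z ^ n with hS
  have hSs : ∀ z : ℂ, ‖z‖ < ρ₁ → HasSum (fun n => (asweSeq C γ α β n : ℂ) * z ^ n) (S z) :=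
    fun z hz => (hasSum_asweSeq C γ hα hαs hβ hβs (hz.trans_le (min_le_right _ _))).summable.hasSum
  -- both are analytic on the disc `‖z‖ < ρ₁`
  have hha : AnalyticOnNhd ℂ h (ball 0 ρ₁) := by
    have := (hasFPowerSeriesOnBall_of_hasSum hρ₁pos hhs).analyticOnNhd
    rwa [Metric.eball_ofReal] at this
  have hSa : AnalyticOnNhd ℂ S (ball 0 ρ₁) := by
    have := (hasFPowerSeriesOnBall_of_hasSum hρ₁pos hSs).analyticOnNhd
    rwa [Metric.eball_ofReal] at this
  -- and they agree at real points
  have hreal : ∀ w : ℝ, |w| < ρ₁ → h w = S w := by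
    intro w hw
    have hwρ : |w| < ρ := hw.trans_le (min_le_left _ _)
    have hwρ₀ : ‖(w : ℂ)‖ < ρ₀ := by
      rw [Complex.norm_real, Real.norm_eq_abs]; exact hw.trans_le (min_le_right _ _)
    have hw₁ : ‖(w : ℂ)‖ < ρ₁ := by rw [Complex.norm_real, Real.norm_eq_abs]; exact hw
    have e1 : h w = ((C * Real.exp (γ * w) * (∏' i, (1 + α i * w)) / ∏' i, (1 - β i * w) : ℝ)
        : ℂ) := by
      refine (hhs w hw₁).unique ?_
      have := Complex.hasSum_ofReal.2 (hrep w hwρ)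
      convert this using 1
      funext n
      push_cast
      ring
    have e2 : S w = (C : ℂ) * Complex.exp ((γ : ℂ) * w) * (∏' i, (1 + (α i : ℂ) * w)) *
        (∏' k, (1 - (β k : ℂ) * w))⁻¹ :=
      (hSs w hw₁).unique (hasSum_asweSeq C γ hα hαs hβ hβs hwρ₀)
    rw [e1, e2, Complex.ofReal_div, Complex.ofReal_mul, Complex.ofReal_mul, Complex.ofReal_exp,
      ofReal_tprod_one_add_mul hαs, ofReal_tprod_one_sub_mul hβs]
    push_cast
    rw [div_eq_mul_inv]
  -- identity theorem on the disc
  have hEq : Set.EqOn h S (ball 0 ρ₁) := by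
    refine hha.eqOn_of_preconnected_of_frequently_eq hSa (convex_ball _ _).isPreconnected
      (mem_ball_self hρ₁pos) ?_
    have ht : Tendsto (fun w : ℝ => (w : ℂ)) (𝓝[≠] 0) (𝓝[≠] 0) := by
      refine tendsto_nhdsWithin_of_tendsto_nhds_of_eventually_within _
        ((Complex.continuous_ofReal.tendsto' 0 0 (by simp)).mono_left nhdsWithin_le_nhds) ?_
      filter_upwards [self_mem_nhdsWithin] with w hw
      simpa using hw
    refine ht.frequently ?_
    have hev : ∀ᶠ w : ℝ in 𝓝[≠] 0, h w = S w := by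
      have : ∀ᶠ w : ℝ in 𝓝 0, |w| < ρ₁ := by
        filter_upwards [Metric.ball_mem_nhds (0 : ℝ) hρ₁pos] with w hw
        rw [Metric.mem_ball, Real.dist_eq, sub_zero] at hw
        exact hw
      filter_upwards [nhdsWithin_le_nhds this] with w hw using hreal w hw
    exact hev.frequently
  -- compare Taylor coefficients
  funext n
  have c1 := taylorCoeff_eq_of_hasSum hρ₁pos hhs n
  have hhs' : ∀ z : ℂ, ‖z‖ < ρ₁ → HasSum (fun n => (asweSeq C γ α β n : ℂ) * z ^ n) (h z) := by
    intro z hz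
    rw [hEq (mem_ball_zero_iff.2 hz)]
    exact hSs z hz
  have c2 := taylorCoeff_eq_of_hasSum hρ₁pos hhs' n
  have : (a n : ℂ) = (asweSeq C γ α β n : ℂ) := c1.symm.trans c2
  exact_mod_cast this

/-! ### D. Thms. 2 and 3 (named facts) and the assembly of Thm. 4 -/

/-- NAMED FACT (**Aissen–Schoenberg–Whitney 1952**, announced as **Aissen–Edrei–Schoenberg–
Whitney 1951, Thm. 2**): "If `a₀, a₁, a₂, …` is a totally positive sequence [one-sided, with
`a₀ = 1`], then its generating function `f(z)` is regular in a neighborhood of the origin and may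
be extended into the whole finite plane, being a meromorphic function of the following special
form `F(z) = e^{g(z)} ∏₁^∞ (1 + α_ν z)/∏₁^∞ (1 - β_ν z)` (`α_ν ≥ 0, β_ν ≥ 0, Σα_ν, Σβ_ν`
convergent), where `g(z)` is an entire function such that the exponential factor `exp{g(z)}`
will by itself also generate a totally positive sequence." Lean form: on some disc `‖z‖ < ρ`
the complex series `Σ aₙ zⁿ` converges to the displayed right-hand side (which is meromorphic on
`ℂ`, so the extension statement is implicit), `g` is entire, and the Taylor sequence `u` of
`e^{g}` (real, `Σ uₙ zⁿ = e^{g(z)}` on `ℂ`) is PF. Users take `(h : asw1952_representation)`;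
it is derived from `ando1987_lowerTriangular_tn` in `ASWMeromorphic.lean`
(`asw1952_representation_of_ando`). [cite: AissenEdreiSchoenbergWhitney1951, Thm. 2] -/
def asw1952_representation : Prop :=
  ∀ a : ℕ → ℝ, IsPolyaFrequencySeq a → a 0 = 1 →
    ∃ (g : ℂ → ℂ) (u α β : ℕ → ℝ),
      Differentiable ℂ g ∧ (∀ i, 0 ≤ α i) ∧ (∀ i, 0 ≤ β i) ∧ Summable α ∧ Summable β ∧
      IsPolyaFrequencySeq u ∧
      (∀ z : ℂ, HasSum (fun n => (u n : ℂ) * z ^ n) (Complex.exp (g z))) ∧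
      ∃ ρ : ℝ, 0 < ρ ∧ ∀ z : ℂ, ‖z‖ < ρ →
        HasSum (fun n => (a n : ℂ) * z ^ n)
          (Complex.exp (g z) * (∏' i, (1 + (α i : ℂ) * z)) / ∏' i, (1 - (β i : ℂ) * z))

/-- NAMED FACT (**Edrei 1952**, announced as **Aissen–Edrei–Schoenberg–Whitney 1951, Thm. 3**):
"If `g(z) = c₁z + c₂z² + …` is entire and such that `e^{g(z)}` generates a totally positive
sequence, then we necessarily have that `c₂ = c₃ = … = 0`, so that `g(z) = c₁z`, (`c₁ ≥ 0`)."
(Obtained "by combining Theorem 2 with a refinement of the Picard theorem for entire functions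
due to R. Nevanlinna.") Lean form: `g` entire with `g(0) = 0` whose exponential has a real PF
Taylor sequence is `z ↦ c z` with `c ≥ 0` real. Users take `(h : edrei1952_exponential_factor)`.
[cite: AissenEdreiSchoenbergWhitney1951, Thm. 3] -/
def edrei1952_exponential_factor : Prop :=
  ∀ g : ℂ → ℂ, Differentiable ℂ g → g 0 = 0 →
    (∃ u : ℕ → ℝ, IsPolyaFrequencySeq u ∧
      ∀ z : ℂ, HasSum (fun n => (u n : ℂ) * z ^ n) (Complex.exp (g z))) →
    ∃ c : ℝ, 0 ≤ c ∧ ∀ z : ℂ, g z = c * z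

/-- **PF ⇒ ASWE representation, from Thms. 2 and 3** (the "⇒" half of AESW 1951, Thm. 4, as
derived in print: "Applying Theorem 3 to the conclusion of Theorem 2 we learn that `g(z)`
appearing in (4) must reduce to the form `g(z) = γz` (`γ ≥ 0`)"). Normalise `a₀ = 1`, subtract
`g(0)` (harmless since `e^{g(0)} = a₀ = 1`), apply Thm. 3, and transport the complex identity to
the real interval `|w| < ρ`. [cite: AissenEdreiSchoenbergWhitney1951, Thm. 4] -/
theorem hasASWERepresentation_of_isPolyaFrequencySeq (h2 : asw1952_representation)
    (h3 : edrei1952_exponential_factor) {a : ℕ → ℝ} (hpf : IsPolyaFrequencySeq a) (h0 : 0 < a 0) :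
    HasASWERepresentation a := by
  -- normalise `a₀ = 1`
  set a' : ℕ → ℝ := fun n => (a 0)⁻¹ * a n with ha'
  have ha'pf : IsPolyaFrequencySeq a' := hpf.smul (inv_nonneg.2 h0.le)
  have ha'0 : a' 0 = 1 := by simp [ha', h0.ne']
  obtain ⟨g, u, α, β, hg, hα, hβ, hαs, hβs, hu, hug, ρ, hρ, hrep⟩ := h2 a' ha'pf ha'0
  -- `e^{g(0)} = 1` (evaluate the representation at `z = 0`)
  have hg0 : Complex.exp (g 0) = 1 := by
    have h := hrep 0 (by simpa using hρ)
    have h1 : HasSum (fun n => (a' n : ℂ) * (0 : ℂ) ^ n) (a' 0 : ℂ) := by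
      have := hasSum_single (f := fun n => (a' n : ℂ) * (0 : ℂ) ^ n) 0 (fun n hn => by simp [hn])
      simpa using this
    have h2' := h1.unique h
    rw [ha'0] at h2'
    simpa using h2'.symm
  -- the normalised exponent `g₁ = g - g(0)`
  set g₁ : ℂ → ℂ := fun z => g z - g 0 with hg₁
  have hg₁d : Differentiable ℂ g₁ := hg.sub_const (g 0)
  have hg₁0 : g₁ 0 = 0 := sub_self _
  have hexp : ∀ z, Complex.exp (g₁ z) = Complex.exp (g z) := fun z => by
    simp only [hg₁]
    rw [Complex.exp_sub, hg0, div_one]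
  obtain ⟨c, hc, hgc⟩ := h3 g₁ hg₁d hg₁0 ⟨u, hu, fun z => by rw [hexp]; exact hug z⟩
  have hexp' : ∀ z, Complex.exp (g z) = Complex.exp ((c : ℂ) * z) := fun z => by
    rw [← hexp, hgc]
  -- the representation of `a = a₀ · a'`
  refine ⟨a 0, c, α, β, h0, hc, hα, hβ, hαs, hβs, ρ, hρ, fun w hw => ?_⟩
  have hw' : ‖(w : ℂ)‖ < ρ := by rwa [Complex.norm_real, Real.norm_eq_abs]
  have h := (hrep w hw').mul_left (a 0 : ℂ)
  rw [hexp' w] at h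
  apply Complex.hasSum_ofReal.1
  have ha0 : (a 0 : ℂ) ≠ 0 := by exact_mod_cast h0.ne'
  have hf : (fun n => ((a n * w ^ n : ℝ) : ℂ)) = fun i => (a 0 : ℂ) * ((a' i : ℂ) * (w : ℂ) ^ i) := by
    funext n
    simp only [ha']
    push_cast
    field_simp
  have hv : (((a 0 * Real.exp (c * w) * (∏' i, (1 + α i * w)) / ∏' i, (1 - β i * w) : ℝ) : ℂ)) =
      (a 0 : ℂ) * ((Complex.exp ((c : ℂ) * w) * ∏' i, (1 + (α i : ℂ) * w)) /
        ∏' i, (1 - (β i : ℂ) * w)) := by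
    rw [Complex.ofReal_div, Complex.ofReal_mul, Complex.ofReal_mul, Complex.ofReal_exp,
      ofReal_tprod_one_add_mul hαs, ofReal_tprod_one_sub_mul hβs]
    push_cast
    ring
  rw [hf, hv]
  exact h

/-- **Assembly of `aswe_edrei` (AESW 1951, Thm. 4) from Thm. 1 (proved), Thm. 2 and Thm. 3 (named
facts).** For `a₀ > 0`: PF `⇒` ASWE representation by
`hasASWERepresentation_of_isPolyaFrequencySeq`; ASWE representation `⇒` PF by
`IsPolyaFrequencySeq.of_hasASWERepresentation`. [cite: AissenEdreiSchoenbergWhitney1951, Thm. 4] -/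
theorem aswe_edrei_of (h2 : asw1952_representation) (h3 : edrei1952_exponential_factor) :
    aswe_edrei :=
  fun _ h0 => ⟨fun hpf => hasASWERepresentation_of_isPolyaFrequencySeq h2 h3 hpf h0,
    fun h => IsPolyaFrequencySeq.of_hasASWERepresentation h⟩

/-- The "⇐" half of `aswe_edrei` holds unconditionally (and without `a₀ > 0`).
[cite: AissenEdreiSchoenbergWhitney1951, Thm. 1] -/
theorem aswe_edrei_mpr (a : ℕ → ℝ) : HasASWERepresentation a → IsPolyaFrequencySeq a :=
  IsPolyaFrequencySeq.of_hasASWERepresentation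

end Literature.Analysis.TotalPositivity
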